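import Summits.ValiantsHypothesis.ValiantsHypothesis.Theses.PolyaContinued
import Summits.ValiantsHypothesis.ValiantsHypothesis.Theorems.PolyaContinuedMonotoneCoverHardRegularity
import Summits.ValiantsHypothesis.ValiantsHypothesis.Theorems.PolyaContinuedMonotoneCoverHardOneLevelDet
import Summits.ValiantsHypothesis.ValiantsHypothesis.Theorems.PolyaContinuedMonotoneCoverHardWidthTwo
import Summits.ValiantsHypothesis.ValiantsHypothesis.Theorems.PolyaContinuedMonotoneCoverHardWidthBet

/-!
# Crux `MonotoneCoverHard` (stmt-ValiantsHypothesis-7421) — PROVED: every label-bijective Pfaffian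
# cover of `per_n` (`n ≥ 3`) is GRADED (von zur Gathen regularity + block count), hence `stub_width`
# and `MonotoneCoverHard` BY NAME

Closing file of the line `Cruxes/MonotoneCoverHard/Lines/width_cut.lean` (v2, single registered stub
`stub_width`; `MonotoneCoverHard_of := monotoneCoverHard_of_widthBet stub_width`).  It is the kernel
port of refuter val-width-7421-d1's sketch `Cruxes/MonotoneCoverHard/GradedSketch.lean` (paper:
`Cruxes/MonotoneCoverHard/REGULARITY-GRADED.md`, THEOREM G), whose single input `Regularity` — von zur
Gathen 1987, Thm. 3.1: an affine-linear square matrix over `ℂ[x_{ij}]` with determinant `per_n`,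
`n ≥ 3`, has constant part of rank `≥ m - 1` — is the tree theorem
`rank_constantCoeff_add_one_of_det_eq_perPoly` (…Theorems/PolyaContinuedMonotoneCoverHardRegularity.lean,
from `Literature.Computability.AlgebraicComplexity.vonzurGathen1987_perm_detRepr_rank_holds`).

* `rank_add_le_aux` — rank is subadditive;
* `rank_const_add_width_le` — the BLOCK COUNT `rank L₀ + c_ℓ(τ) ≤ m`: for a labelled edge set with
  signs and a level function, the signed matrix `L₀` of `1`-edges has its rows of level `≤ ℓ` inside
  the columns of level `≤ ℓ`, and a weight-nonzero perfect matching `τ` injects the rows of level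
  `> ℓ` together with its `c_ℓ(τ)` variable rows of level `ℓ` into the columns of level `> ℓ`;
* `width_le_one` — GRADEDNESS: every level of every label-bijective Pfaffian cover of `per_n`, `n ≥ 3`,
  with a level function on its used edges has width `≤ 1` (regularity applied to the signed used-label
  matrix, whose determinant is `per_n` by `det_signedLabel_eq_perPoly` and whose constant part is the
  signed matrix of used `1`-edges, against the block count on the used-edge sub-cover);
* `widthBet_of_cover` — at one cover: a balanced level `h ≥ 1` (`exists_balanced_level`) with
  `c_h + c_{h-1} ≤ 2`, matching-independent (`varCount_eq`, `belowCount_eq`, `card_var_eq_n`);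
* `stub_width` — the REGISTERED STUB verbatim, with `d = 2`, `n₀ = 3`;
* `MonotoneCoverHard_proof : MonotoneCoverHard` — the crux BY NAME (`monotoneCoverHard_of_widthBet`).

Honest label: this settles the route's MONOTONE crux (no quasi-polynomial Pfaffian bipartite graph has
its perfect matchings in `{0,1,x}`-label-bijection with `S_n`).  VP ≠ VNP is NOT moved: the transfer
from `VP_det` computations to such cancellation-free covers is where Valiant's hypothesis lives and is
not touched here.  No definitions.
-/

namespace Summit.ValiantsHypothesis.ValiantsHypothesis.Theorems.PolyaContinuedMonotoneCoverHard

-- summit = sub-problem name (single-conjunct summit, D-0017 layout), so the namespace repeats it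
set_option linter.dupNamespace false

open scoped Classical
open Finset
open Summit.ValiantsHypothesis.ValiantsHypothesis.Theses.PolyaContinued (MonotoneCoverHard)

/-- Rank is subadditive: `rank (M₁ + M₂) ≤ rank M₁ + rank M₂` (the range of the sum lies in the sup
of the ranges). -/
theorem rank_add_le_aux {p q : Type*} [Fintype p] [Fintype q] (M₁ M₂ : Matrix p q ℂ) :
    (M₁ + M₂).rank ≤ M₁.rank + M₂.rank := by
  unfold Matrix.rank
  rw [Matrix.mulVecLin_add]
  calc Module.finrank ℂ (LinearMap.range (M₁.mulVecLin + M₂.mulVecLin))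
      ≤ Module.finrank ℂ (LinearMap.range M₁.mulVecLin ⊔ LinearMap.range M₂.mulVecLin :
          Submodule ℂ (p → ℂ)) := by
        apply Submodule.finrank_mono
        rintro v ⟨x, rfl⟩
        exact Submodule.add_mem_sup ⟨x, rfl⟩ ⟨x, rfl⟩
    _ ≤ _ := Submodule.finrank_add_le_finrank_add_finrank _ _

/-- A variable `X k` is not the constant polynomial `1` over `ℂ` (total degrees `1 ≠ 0`). -/
theorem X_ne_one' {σ : Type*} (k : σ) : (MvPolynomial.X k : MvPolynomial σ ℂ) ≠ 1 := by
  intro h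
  have := congrArg MvPolynomial.totalDegree h
  simp [MvPolynomial.totalDegree_X] at this

/-- **(BC) block count.**  For a labelled edge set `(E, a)` with signs `s` and a level function `g`
(`hvar`/`hone` on the nonzero edges), the constant part `L₀` (the signed `1`-edges) satisfies
`rank L₀ + c_ℓ(τ) ≤ m` for every weight-nonzero perfect matching `τ` and every level `ℓ`, where
`c_ℓ(τ)` is the number of variable edges of `τ` leaving row level `ℓ`: the rows of level `≤ ℓ` of `L₀`
live in the columns of level `≤ ℓ`, and `τ` injects the rows of level `> ℓ` together with the `c_ℓ(τ)`
variable rows of level `ℓ` into the columns of level `> ℓ`.  (REGULARITY-GRADED.md §1 (3).) -/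
theorem rank_const_add_width_le (n m : ℕ) (E : Finset (Fin m × Fin m))
    (a : Fin m × Fin m → MvPolynomial (Fin n × Fin n) ℂ) (s : Fin m × Fin m → ℂ)
    (g : Fin m ⊕ Fin m → ℕ)
    (hvar : ∀ i j, (i, j) ∈ E → (∃ k, a (i, j) = MvPolynomial.X k) →
      g (Sum.inr j) = g (Sum.inl i) + 1)
    (hone : ∀ i j, (i, j) ∈ E → a (i, j) ≠ 0 → (¬ ∃ k, a (i, j) = MvPolynomial.X k) →
      g (Sum.inr j) = g (Sum.inl i))
    (τ : Equiv.Perm (Fin m)) (hτ : ∀ i, (i, τ i) ∈ E ∧ a (i, τ i) ≠ 0) (ℓ : ℕ) :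
    (Matrix.of fun i j => if (i, j) ∈ E ∧ a (i, j) = 1 then s (i, j) else 0 :
        Matrix (Fin m) (Fin m) ℂ).rank +
      (univ.filter fun i : Fin m => (∃ k, a (i, τ i) = MvPolynomial.X k) ∧ g (Sum.inl i) = ℓ).card
      ≤ m := by
  set L0 : Matrix (Fin m) (Fin m) ℂ :=
    Matrix.of fun i j => if (i, j) ∈ E ∧ a (i, j) = 1 then s (i, j) else 0 with hL0
  -- levels of 1-edges agree
  have hlev1 : ∀ i j, L0 i j ≠ 0 → g (Sum.inr j) = g (Sum.inl i) := by
    intro i j h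
    simp only [hL0, Matrix.of_apply] at h
    by_cases hc : (i, j) ∈ E ∧ a (i, j) = 1
    · refine hone i j hc.1 (by rw [hc.2]; exact one_ne_zero) ?_
      rintro ⟨k, hk⟩
      exact X_ne_one' k (hk.symm.trans hc.2)
    · simp [hc] at h
  -- diagonal projectors
  set dlo : Fin m → ℂ := fun i => if g (Sum.inl i) ≤ ℓ then 1 else 0 with hdlo
  set dhi : Fin m → ℂ := fun i => if g (Sum.inl i) ≤ ℓ then 0 else 1 with hdhi
  set dc : Fin m → ℂ := fun j => if g (Sum.inr j) ≤ ℓ then 1 else 0 with hdc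
  have hsplit : L0 = Matrix.diagonal dlo * L0 * Matrix.diagonal dc + Matrix.diagonal dhi * L0 := by
    ext i j
    simp only [Matrix.add_apply, Matrix.mul_diagonal, Matrix.diagonal_mul, hdlo, hdhi, hdc]
    by_cases h0 : L0 i j = 0
    · simp [h0]
    · have hl := hlev1 i j h0
      by_cases hi : g (Sum.inl i) ≤ ℓ
      · have hj : g (Sum.inr j) ≤ ℓ := by omega
        simp [hi, hj]
      · simp [hi]
  -- rank bounds for the two pieces
  have hr1 : (Matrix.diagonal dlo * L0 * Matrix.diagonal dc).rank ≤
      (univ.filter fun j : Fin m => g (Sum.inr j) ≤ ℓ).card := by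
    refine (Matrix.rank_mul_le_right _ _).trans ?_
    rw [Matrix.rank_diagonal, Fintype.card_subtype]
    refine (Finset.card_le_card ?_)
    intro j hj
    simp only [mem_filter, mem_univ, true_and, hdc] at hj ⊢
    by_contra h
    simp [h] at hj
  have hr2 : (Matrix.diagonal dhi * L0).rank ≤
      (univ.filter fun i : Fin m => ¬ g (Sum.inl i) ≤ ℓ).card := by
    refine (Matrix.rank_mul_le_left _ _).trans ?_
    rw [Matrix.rank_diagonal, Fintype.card_subtype]
    refine (Finset.card_le_card ?_)
    intro i hi
    simp only [mem_filter, mem_univ, true_and, hdhi] at hi ⊢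
    by_contra h
    simp [h] at hi
  have hrank : L0.rank ≤ (univ.filter fun j : Fin m => g (Sum.inr j) ≤ ℓ).card +
      (univ.filter fun i : Fin m => ¬ g (Sum.inl i) ≤ ℓ).card := by
    calc L0.rank = (Matrix.diagonal dlo * L0 * Matrix.diagonal dc + Matrix.diagonal dhi * L0).rank := by
          rw [← hsplit]
      _ ≤ _ := rank_add_le_aux _ _
      _ ≤ _ := Nat.add_le_add hr1 hr2
  -- the injection via τ into the high columns
  have hinj : (univ.filter fun i : Fin m => ¬ g (Sum.inl i) ≤ ℓ).card +
      (univ.filter fun i : Fin m => (∃ k, a (i, τ i) = MvPolynomial.X k) ∧ g (Sum.inl i) = ℓ).card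
      ≤ (univ.filter fun j : Fin m => ¬ g (Sum.inr j) ≤ ℓ).card := by
    rw [← Finset.card_union_of_disjoint]
    · rw [← Finset.card_image_of_injective _ τ.injective]
      refine Finset.card_le_card ?_
      intro j hj
      simp only [mem_image, mem_union, mem_filter, mem_univ, true_and] at hj ⊢
      obtain ⟨i, hi, rfl⟩ := hj
      obtain ⟨hE, ha⟩ := hτ i
      rcases hi with hi | ⟨⟨k, hk⟩, hil⟩
      · by_cases hv : ∃ k, a (i, τ i) = MvPolynomial.X k
        · have := hvar i (τ i) hE hv; omega
        · have := hone i (τ i) hE ha hv; omega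
      · have := hvar i (τ i) hE ⟨k, hk⟩; omega
    · exact Finset.disjoint_filter.2 fun i _ h1 h2 => by omega
  -- column count
  have hcols : (univ.filter fun j : Fin m => g (Sum.inr j) ≤ ℓ).card +
      (univ.filter fun j : Fin m => ¬ g (Sum.inr j) ≤ ℓ).card = m := by
    rw [Finset.card_filter_add_card_filter_not, card_univ, Fintype.card_fin]
  omega

section Cover

variable {m n : ℕ} (E : Finset (Fin m × Fin m)) (a : Fin m × Fin m → MvPolynomial (Fin n × Fin n) ℂ)
  (g : Fin m ⊕ Fin m → ℕ)
  (hvarU : ∀ τ : Equiv.Perm (Fin m), (∀ i, (i, τ i) ∈ E ∧ a (i, τ i) ≠ 0) → ∀ i,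
    (∃ k, a (i, τ i) = MvPolynomial.X k) → g (Sum.inr (τ i)) = g (Sum.inl i) + 1)
  (honeU : ∀ τ : Equiv.Perm (Fin m), (∀ i, (i, τ i) ∈ E ∧ a (i, τ i) ≠ 0) → ∀ i,
    (¬ ∃ k, a (i, τ i) = MvPolynomial.X k) → g (Sum.inr (τ i)) = g (Sum.inl i))

include hvarU in
/-- Level hypotheses along the weight-nonzero perfect matchings give `hvar` on every edge of the
used-edge sub-cover. -/
theorem hvar_usedEdges : ∀ i j, (i, j) ∈ E.filter (fun e => a e ≠ 0 ∧ ∃ σ : Equiv.Perm (Fin m),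
      (∀ k, (k, σ k) ∈ E ∧ a (k, σ k) ≠ 0) ∧ σ e.1 = e.2) →
    (∃ k, a (i, j) = MvPolynomial.X k) → g (Sum.inr j) = g (Sum.inl i) + 1 := by
  intro i j hij hv
  simp only [Finset.mem_filter] at hij
  obtain ⟨-, -, σ, hσ, hσi⟩ := hij
  subst hσi
  exact hvarU σ hσ i hv

include honeU in
/-- Level hypotheses along the weight-nonzero perfect matchings give `hone` on every edge of the
used-edge sub-cover. -/
theorem hone_usedEdges : ∀ i j, (i, j) ∈ E.filter (fun e => a e ≠ 0 ∧ ∃ σ : Equiv.Perm (Fin m),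
      (∀ k, (k, σ k) ∈ E ∧ a (k, σ k) ≠ 0) ∧ σ e.1 = e.2) → a (i, j) ≠ 0 →
    (¬ ∃ k, a (i, j) = MvPolynomial.X k) → g (Sum.inr j) = g (Sum.inl i) := by
  intro i j hij _ hnv
  simp only [Finset.mem_filter] at hij
  obtain ⟨-, -, σ, hσ, hσi⟩ := hij
  subst hσi
  exact honeU σ hσ i hnv

include hvarU honeU in
/-- **GRADEDNESS (THEOREM G of REGULARITY-GRADED.md).**  Every label-bijective Pfaffian cover of
`per_n`, `n ≥ 3`, with a level function on its used edges has ALL WIDTHS `≤ 1`: von zur Gathen's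
regularity (`rank_constantCoeff_add_one_of_det_eq_perPoly`) applied to the signed used-label matrix —
its determinant is `per_n` by `det_signedLabel_eq_perPoly`, its constant part is the signed matrix of
used `1`-edges — against the block count `rank_const_add_width_le` on the used-edge sub-cover. -/
theorem width_le_one (hn : 3 ≤ n)
    (hsig : ∃ s : Fin m × Fin m → ℂ, (∀ e, s e = 1 ∨ s e = -1) ∧
        (Matrix.of fun i j => if (i, j) ∈ E then MvPolynomial.C (s (i, j)) * MvPolynomial.X (i, j)
            else 0 : Matrix (Fin m) (Fin m) (MvPolynomial (Fin m × Fin m) ℂ)).det =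
          (Matrix.of fun i j => if (i, j) ∈ E then MvPolynomial.X (i, j) else 0 :
            Matrix (Fin m) (Fin m) (MvPolynomial (Fin m × Fin m) ℂ)).permanent)
    (ha : ∀ e, (∃ j, a e = MvPolynomial.X j) ∨ a e = 0 ∨ a e = 1)
    (hcov : Literature.Computability.AlgebraicComplexity.perPoly (Fin n) ℂ =
        MvPolynomial.aeval a (Matrix.of fun i j => if (i, j) ∈ E then MvPolynomial.X (i, j) else 0 :
            Matrix (Fin m) (Fin m) (MvPolynomial (Fin m × Fin m) ℂ)).permanent)
    (τ : Equiv.Perm (Fin m)) (hτ : ∀ i, (i, τ i) ∈ E ∧ a (i, τ i) ≠ 0) (ℓ : ℕ) :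
    (univ.filter fun i : Fin m => (∃ k, a (i, τ i) = MvPolynomial.X k) ∧ g (Sum.inl i) = ℓ).card
      ≤ 1 := by
  obtain ⟨s, hs⟩ := exists_polyaSigning_of_symbolic E hsig
  -- the signed used-label matrix and its determinant
  let M : Matrix (Fin m) (Fin m) (MvPolynomial (Fin n × Fin n) ℂ) := fun i j =>
    if ∃ τ : Equiv.Perm (Fin m), (∀ k, (k, τ k) ∈ E ∧ a (k, τ k) ≠ 0) ∧ τ i = j
    then MvPolynomial.C ((s (i, j) : ℤ) : ℂ) * a (i, j) else 0
  have hM : ∀ i j, M i j = if ∃ τ : Equiv.Perm (Fin m), (∀ k, (k, τ k) ∈ E ∧ a (k, τ k) ≠ 0) ∧ τ i = j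
      then MvPolynomial.C ((s (i, j) : ℤ) : ℂ) * a (i, j) else 0 := fun i j => rfl
  have hdet : M.det = Literature.Computability.AlgebraicComplexity.perPoly (Fin n) ℂ :=
    det_signedLabel_eq_perPoly E a hcov s hs M hM
  -- REGULARITY (von zur Gathen 1987, Thm. 3.1): `m ≤ rank M(0) + 1`
  have hreg := rank_constantCoeff_add_one_of_det_eq_perPoly hn M hdet
  -- its constant part is the signed matrix of used 1-edges
  have hconst : M.map MvPolynomial.constantCoeff =
      (Matrix.of fun i j => if (i, j) ∈ E.filter (fun e => a e ≠ 0 ∧ ∃ σ : Equiv.Perm (Fin m),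
          (∀ k, (k, σ k) ∈ E ∧ a (k, σ k) ≠ 0) ∧ σ e.1 = e.2) ∧ a (i, j) = 1
        then (fun e : Fin m × Fin m => ((s e : ℤ) : ℂ)) (i, j) else 0) := by
    ext i j
    rw [Matrix.map_apply, hM, Matrix.of_apply]
    simp only [Finset.mem_filter]
    by_cases hu : ∃ τ : Equiv.Perm (Fin m), (∀ k, (k, τ k) ∈ E ∧ a (k, τ k) ≠ 0) ∧ τ i = j
    · obtain ⟨ρ, hρ, hρi⟩ := hu
      have hEa : (i, j) ∈ E ∧ a (i, j) ≠ 0 := by rw [← hρi]; exact hρ i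
      rw [if_pos ⟨ρ, hρ, hρi⟩]
      rcases ha (i, j) with ⟨k, hk⟩ | h0 | h1
      · rw [if_neg (fun hc => X_ne_one' k (hk.symm.trans hc.2)), hk, map_mul,
          MvPolynomial.constantCoeff_C, MvPolynomial.constantCoeff_X, mul_zero]
      · exact absurd h0 hEa.2
      · rw [if_pos ⟨⟨hEa.1, hEa.2, ρ, hρ, hρi⟩, h1⟩, h1, mul_one, MvPolynomial.constantCoeff_C]
    · rw [if_neg hu, map_zero, if_neg]
      rintro ⟨⟨-, -, σ, hσ, hσi⟩, -⟩
      exact hu ⟨σ, hσ, hσi⟩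
  have hbc := rank_const_add_width_le n m (E.filter (fun e => a e ≠ 0 ∧ ∃ σ : Equiv.Perm (Fin m),
      (∀ k, (k, σ k) ∈ E ∧ a (k, σ k) ≠ 0) ∧ σ e.1 = e.2)) a (fun e => ((s e : ℤ) : ℂ)) g
    (hvar_usedEdges E a g hvarU) (hone_usedEdges E a g honeU) τ ((good_usedEdges_iff E a τ).2 hτ) ℓ
  rw [hconst] at hreg
  dsimp only at hbc hreg
  omega

include hvarU honeU in
/-- **The WIDTH BET at one cover**: for a label-bijective Pfaffian cover of `per_n`, `n ≥ 3`, and a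
level function on its used edges there is a balanced level `h ≥ 1` with matching-independent widths
`c_h + c_{h-1} ≤ 2` (widths `≤ 1` by `width_le_one`; `exists_balanced_level`, `varCount_eq`,
`belowCount_eq`, `card_var_eq_n` from …WidthTwo.lean). -/
theorem widthBet_of_cover (hn : 3 ≤ n)
    (hsig : ∃ s : Fin m × Fin m → ℂ, (∀ e, s e = 1 ∨ s e = -1) ∧
        (Matrix.of fun i j => if (i, j) ∈ E then MvPolynomial.C (s (i, j)) * MvPolynomial.X (i, j)
            else 0 : Matrix (Fin m) (Fin m) (MvPolynomial (Fin m × Fin m) ℂ)).det =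
          (Matrix.of fun i j => if (i, j) ∈ E then MvPolynomial.X (i, j) else 0 :
            Matrix (Fin m) (Fin m) (MvPolynomial (Fin m × Fin m) ℂ)).permanent)
    (ha : ∀ e, (∃ j, a e = MvPolynomial.X j) ∨ a e = 0 ∨ a e = 1)
    (hcov : Literature.Computability.AlgebraicComplexity.perPoly (Fin n) ℂ =
        MvPolynomial.aeval a (Matrix.of fun i j => if (i, j) ∈ E then MvPolynomial.X (i, j) else 0 :
            Matrix (Fin m) (Fin m) (MvPolynomial (Fin m × Fin m) ℂ)).permanent) :
    ∃ h ch cq : ℕ, 1 ≤ h ∧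
      (∀ τ : Equiv.Perm (Fin m), (∀ i, (i, τ i) ∈ E ∧ a (i, τ i) ≠ 0) →
        n ≤ 3 * (Finset.univ.filter fun i : Fin m =>
            (∃ k, a (i, τ i) = MvPolynomial.X k) ∧ g (Sum.inl i) < h).card ∧
          3 * (Finset.univ.filter fun i : Fin m =>
            (∃ k, a (i, τ i) = MvPolynomial.X k) ∧ g (Sum.inl i) < h).card ≤ 2 * n) ∧
      (∀ τ : Equiv.Perm (Fin m), (∀ i, (i, τ i) ∈ E ∧ a (i, τ i) ≠ 0) →
        (Finset.univ.filter fun i : Fin m =>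
          (∃ k, a (i, τ i) = MvPolynomial.X k) ∧ g (Sum.inl i) = h).card = ch) ∧
      (∀ τ : Equiv.Perm (Fin m), (∀ i, (i, τ i) ∈ E ∧ a (i, τ i) ≠ 0) →
        (Finset.univ.filter fun i : Fin m =>
          (∃ k, a (i, τ i) = MvPolynomial.X k) ∧ g (Sum.inl i) = h - 1).card = cq) ∧
      ch + cq ≤ 2 := by
  by_cases hex : ∃ τ₀ : Equiv.Perm (Fin m), ∀ i, (i, τ₀ i) ∈ E ∧ a (i, τ₀ i) ≠ 0
  · obtain ⟨τ₀, hτ₀⟩ := hex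
    have hw : ∀ ℓ, (univ.filter fun i : Fin m =>
        (∃ k, a (i, τ₀ i) = MvPolynomial.X k) ∧ g (Sum.inl i) = ℓ).card ≤ 1 :=
      fun ℓ => width_le_one E a g hvarU honeU hn hsig ha hcov τ₀ hτ₀ ℓ
    have htot := card_var_eq_n E a ha hcov τ₀ hτ₀
    obtain ⟨h, h1, hlo, hhi⟩ := exists_balanced_level a g τ₀ (by omega) htot
      (fun ℓ => by have := hw ℓ; omega)
    have hτ₀' := (good_usedEdges_iff E a τ₀).2 hτ₀
    refine ⟨h,
      (univ.filter fun i : Fin m => (∃ k, a (i, τ₀ i) = MvPolynomial.X k) ∧ g (Sum.inl i) = h).card,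
      (univ.filter fun i : Fin m =>
        (∃ k, a (i, τ₀ i) = MvPolynomial.X k) ∧ g (Sum.inl i) = h - 1).card,
      h1, fun τ hτ => ?_, fun τ hτ => ?_, fun τ hτ => ?_, ?_⟩
    · rw [belowCount_eq _ a g (hvar_usedEdges E a g hvarU) (hone_usedEdges E a g honeU) τ τ₀
        ((good_usedEdges_iff E a τ).2 hτ) hτ₀' h]
      exact ⟨hlo, hhi⟩
    · exact varCount_eq _ a g (hvar_usedEdges E a g hvarU) (hone_usedEdges E a g honeU) τ τ₀
        ((good_usedEdges_iff E a τ).2 hτ) hτ₀' h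
    · exact varCount_eq _ a g (hvar_usedEdges E a g hvarU) (hone_usedEdges E a g honeU) τ τ₀
        ((good_usedEdges_iff E a τ).2 hτ) hτ₀' (h - 1)
    · have := hw h
      have := hw (h - 1)
      omega
  · refine ⟨1, 0, 0, le_rfl, fun τ hτ => absurd ⟨τ, hτ⟩ hex, fun τ hτ => absurd ⟨τ, hτ⟩ hex,
      fun τ hτ => absurd ⟨τ, hτ⟩ hex, by omega⟩

end Cover

/-- **The registered stub `stub_width` of the line `width_cut` (v2), verbatim** — THE WIDTH BET:
uniformly (`∃ d n₀`; here `d = 2`, `n₀ = 3`), for every label-bijective Pfaffian cover of `per_n`,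
`n ≥ n₀`, and every level function `g` on its used edges, some level `h ≥ 1` is balanced and the
widths `c_h, c_{h-1}` satisfy `c_h + c_{h-1} ≤ (log₂ m + d)^d`.  By `widthBet_of_cover` the bound is
in fact the constant `2` (every such cover is graded). -/
theorem stub_width :
    ∃ d n₀ : ℕ, ∀ (n m : ℕ) (E : Finset (Fin m × Fin m))
      (a : Fin m × Fin m → MvPolynomial (Fin n × Fin n) ℂ), n₀ ≤ n →
      (∃ s : Fin m × Fin m → ℂ, (∀ e, s e = 1 ∨ s e = -1) ∧
        (Matrix.of fun i j => if (i, j) ∈ E then MvPolynomial.C (s (i, j)) * MvPolynomial.X (i, j)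
            else 0 : Matrix (Fin m) (Fin m) (MvPolynomial (Fin m × Fin m) ℂ)).det =
          (Matrix.of fun i j => if (i, j) ∈ E then MvPolynomial.X (i, j) else 0 :
            Matrix (Fin m) (Fin m) (MvPolynomial (Fin m × Fin m) ℂ)).permanent) →
      (∀ e, (∃ j, a e = MvPolynomial.X j) ∨ a e = 0 ∨ a e = 1) →
      Literature.Computability.AlgebraicComplexity.perPoly (Fin n) ℂ =
        MvPolynomial.aeval a (Matrix.of fun i j => if (i, j) ∈ E then MvPolynomial.X (i, j) else 0 :
            Matrix (Fin m) (Fin m) (MvPolynomial (Fin m × Fin m) ℂ)).permanent →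
      ∀ g : Fin m ⊕ Fin m → ℕ,
        (∀ τ : Equiv.Perm (Fin m), (∀ i, (i, τ i) ∈ E ∧ a (i, τ i) ≠ 0) → ∀ i,
          (∃ k, a (i, τ i) = MvPolynomial.X k) → g (Sum.inr (τ i)) = g (Sum.inl i) + 1) →
        (∀ τ : Equiv.Perm (Fin m), (∀ i, (i, τ i) ∈ E ∧ a (i, τ i) ≠ 0) → ∀ i,
          (¬ ∃ k, a (i, τ i) = MvPolynomial.X k) → g (Sum.inr (τ i)) = g (Sum.inl i)) →
        ∃ h ch cq : ℕ, 1 ≤ h ∧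
          (∀ τ : Equiv.Perm (Fin m), (∀ i, (i, τ i) ∈ E ∧ a (i, τ i) ≠ 0) →
            n ≤ 3 * (Finset.univ.filter fun i : Fin m =>
                (∃ k, a (i, τ i) = MvPolynomial.X k) ∧ g (Sum.inl i) < h).card ∧
              3 * (Finset.univ.filter fun i : Fin m =>
                (∃ k, a (i, τ i) = MvPolynomial.X k) ∧ g (Sum.inl i) < h).card ≤ 2 * n) ∧
          (∀ τ : Equiv.Perm (Fin m), (∀ i, (i, τ i) ∈ E ∧ a (i, τ i) ≠ 0) →
            (Finset.univ.filter fun i : Fin m =>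
              (∃ k, a (i, τ i) = MvPolynomial.X k) ∧ g (Sum.inl i) = h).card = ch) ∧
          (∀ τ : Equiv.Perm (Fin m), (∀ i, (i, τ i) ∈ E ∧ a (i, τ i) ≠ 0) →
            (Finset.univ.filter fun i : Fin m =>
              (∃ k, a (i, τ i) = MvPolynomial.X k) ∧ g (Sum.inl i) = h - 1).card = cq) ∧
          ch + cq ≤ (Nat.log 2 m + d) ^ d := by
  refine ⟨2, 3, fun n m E a hn hsig ha hcov g hvarU honeU => ?_⟩
  obtain ⟨h, ch, cq, h1, hbal, hch, hcq, hsum⟩ :=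
    widthBet_of_cover E a g hvarU honeU hn hsig ha hcov
  refine ⟨h, ch, cq, h1, hbal, hch, hcq, hsum.trans ?_⟩
  nlinarith [Nat.zero_le (Nat.log 2 m)]

/-- **Crux `MonotoneCoverHard` (stmt-ValiantsHypothesis-7421), PROVED BY NAME**: no quasi-polynomial
family of label-bijective Pfaffian covers of `per_n` exists — by `monotoneCoverHard_of_widthBet`
(…WidthBet.lean) applied to `stub_width`.  VP ≠ VNP is not moved (monotone statement). -/
theorem MonotoneCoverHard_proof : MonotoneCoverHard :=
  monotoneCoverHard_of_widthBet stub_width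

end Summit.ValiantsHypothesis.ValiantsHypothesis.Theorems.PolyaContinuedMonotoneCoverHard
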